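import Literature.Analysis.FluidPDE.Tao2016AveragedNS.ReachHalfPlane
import Literature.Analysis.FluidPDE.Tao2016AveragedNS.ReachScaling
import HarnessLib

/-!
# Tao's gate at every level: the cone certificates on the weighted half-plane, both sides

**Honest framing.** low prior, high value-of-information experiment on Tao's machine paradigm; NOT a
claim that NS blows up. This file is Literature-side bookkeeping for the cell `pub-fluidc`: it
formalises [cite: Tao2016AveragedNS, §5.5 Theorem 5.3, Remark 6.1] (the delayed, abrupt firing of
the five-mode quadratic circuit (5.5) and its scaling symmetry) along FORCED PSEUDO-ORBITS, in bp3's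
typed `ReachCertificate` interface. Nothing here is a statement about the Navier–Stokes equations.

**What is new.** `ReachScaling.lean` transported the SUFFICIENCY side of the reach interface to every
level `c₀ > 0` (inputs `c • q`, `c ≥ c₀`: the cone certificates `taoReachCone`, under the sharp
budget `ρ + 2εd/c₀² < 1.2532·u`, `u = ε²e^{-M}/√M`), and `ReachHalfPlane.lean` removed the a-priori
budget at level one (`taoReachHalfPlane`: the whole open weighted half-plane
`ρ + 1.27εd/√M < 1.2532·u`; defect axis decided to the factor `1.0135`). Here the two are combined
and the NECESSITY side is transported as well:

* §1 (no standing hypotheses for the defect axis): the RESCALED SEED-FREE ORBIT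
  `t ↦ c₀ • seedFreeOrbit ε (c₀t)` is an admissible curve from `c₀ • delayInit` with defect
  `c₀²·ε²e^{-M}` and output `ã ≡ 0` (`isEmpty_reachCertificate_of_sq_mul_seed_le`); the RESCALED
  NEGATIVE-KICK DUD `t ↦ c₀ • Φ_{c₀t}(kickInit (-κ))` is an exact orbit from the level-`c₀` copy of a
  point of `closedBall delayInit (1.2535u)` with `|ã| ≤ 6c₀e^{-M}` up to time `2/c₀`
  (`isEmpty_reachCertificate_of_ge_level`). Hence for the cone classes
  `coneFrom c₀ (closedBall delayInit ρ) → coneFrom c₀ (firedSet K 6 4)`: NO certificate once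
  `εd ≥ c₀²·ε²e^{-M}` (any cycle time; `isEmpty_taoReachCone_of_seed_le`) or once `ρ ≥ 1.2535u`
  (cycle times `≤ 2/c₀`; `isEmpty_taoReachCone_of_ge`).
* §2: `taoReachCone_wide` / `taoReachBand_wide` — the cone and band certificates for EVERY
  `ρ, εd ≥ 0` with `ρ + 1.27·(εd/c₀²)/√M < 1.2532·u` (cycle time `2/c₀`, working region `univ`);
  `taoReachCone_defectAxis_wide`: on the level-`c₀` defect axis a certificate for every
  `εd < 0.9867·c₀²·ε²e^{-M}`.
* §3: `cone_defectAxis_phases_wide`, `taoReachCone_phases_wide` — the `(ρ, εd)` portrait at level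
  `c₀` is the level-one portrait of `ReachHalfPlane.lean` in the coordinates `(ρ, εd/c₀²)` with the
  clock `c₀t`, ON BOTH SIDES: certified on the open weighted half-plane, impossible for
  `ρ ≥ 1.2535u` or `εd ≥ c₀²ε²e^{-M}`; the forcing a level-`c₀` Theorem-5.3 stage tolerates is `c₀²`
  times the seed rate, decided to the factor `1.0135` at every level; and the design hand-off chains
  the wide cone certificates (`handOff_taoReachCone_wide_chains`).

What is NOT claimed: a weighted necessity theorem off the axes (the strip
`1.2532u - 1.27(εd/c₀²)/√M ≤ ρ < 1.2535u` stays undecided at every level, as at level one); the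
pre-load impossibility for cycle times `> 2/c₀` (the dud is followed for two units of its own clock
only); anything fluid-side; anything about Navier–Stokes.
-/

noncomputable section

open Real Set MeasureTheory Metric
open scoped NNReal
open Literature.Analysis.FluidPDE.FluidComputer (ReachCertificate)

namespace Literature.Analysis.FluidPDE.Tao2016AveragedNS

/-! ## §1. Necessity at every level: the rescaled adversaries

Both adversaries of ReachCertificateSharp.lean — the seed-free orbit (defect axis) and the
negative-kick dud (pre-load axis) — are transported to level `c₀` by the scaling symmetry
`X ↦ c₀ • X(c₀ t)` of the member (`delayCircuitWith_smul`): the rescaled seed-free orbit is an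
admissible curve from `c₀ • delayInit` with defect `c₀²·ε²e^{-M}` and output `ã ≡ 0`; the rescaled
dud is an EXACT orbit from `c₀ • kickInit (-κ)` with `|ã| ≤ 6c₀e^{-M}` on `[0, 2/c₀]`. -/

/-- Members of a cone (level `c₀ > 0`) over a fired set `firedSet K e m` with `e < K²⁰` have
POSITIVE output coordinate: `p = c • w`, `c ≥ c₀ > 0`, `w 4 ≥ 1 - e/K²⁰ > 0`. [folklore] -/
theorem four_pos_of_mem_coneFrom_firedSet {K e m c₀ : ℝ} (hK : 0 < K) (he : e < K ^ 20)
    (hc₀ : 0 < c₀) {p : Fin 5 → ℝ} (hp : p ∈ coneFrom c₀ (firedSet K e m)) : 0 < p 4 := by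
  obtain ⟨c, hc, w, hw, rfl⟩ := hp
  have h1 := (mem_firedSet_iff.1 hw).1
  have h2 : e / K ^ 20 < 1 := (div_lt_one (pow_pos hK 20)).2 he
  have hw4 : 0 < w 4 := by
    have := (abs_le.1 h1).1
    linarith
  have hc0 : 0 < c := lt_of_lt_of_le hc₀ hc
  simpa [Pi.smul_apply, smul_eq_mul] using mul_pos hc0 hw4

/-- Members of a cone (level `c₀ ≥ 0`) over `firedSet K e m` with `e ≤ K²⁰/2` (`K > 0`) have
output coordinate at least `c₀/2`. [folklore] -/
theorem half_le_four_of_mem_coneFrom_firedSet {K e m c₀ : ℝ} (hK : 0 < K) (he : e ≤ K ^ 20 / 2)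
    (hc₀ : 0 ≤ c₀) {p : Fin 5 → ℝ} (hp : p ∈ coneFrom c₀ (firedSet K e m)) : c₀ / 2 ≤ p 4 := by
  obtain ⟨c, hc, w, hw, rfl⟩ := hp
  have h := firedSet_subset_half hK he hw
  change 1 / 2 ≤ w 4 at h
  have hc0 : 0 ≤ c := hc₀.trans hc
  have : c₀ / 2 ≤ c * w 4 := by nlinarith
  simpa [Pi.smul_apply, smul_eq_mul] using this

/-- **No reach certificate from a scaled datum at defect level `≥ c₀²·ε²e^{-M}`** — any member
`delayCircuitWith K M ε` (no hypothesis on `K`, `M`, `ε`), any level `c₀ > 0`, any open `U`, any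
cycle time `τc ≥ 0`, any input class `Ain ∋ c₀ • delayInit`, any output class `Aout ⊆ {ã ≠ 0}`:
the RESCALED SEED-FREE ORBIT `t ↦ c₀ • seedFreeOrbit ε (c₀ t)` is an admissible curve from
`c₀ • delayInit` (defect `≤ c₀²·ε²e^{-M} ≤ εd`, by `delayCircuitWith_smul`) with `ã ≡ 0`, while the
interface's continuation principle `ReachCertificate.reach` would make it visit `Aout`
(`isEmpty_reachCertificate_of_seed_le`: `c₀ = 1`). [cite: Tao2016AveragedNS, §5.5 (5.5)–(5.6), Remark 6.1] -/
theorem isEmpty_reachCertificate_of_sq_mul_seed_le {K M ε c₀ : ℝ} (hc₀ : 0 < c₀)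
    {U : Set (Fin 5 → ℝ)} (hU : IsOpen U) {εd τc : ℝ}
    (hεd : c₀ ^ 2 * (ε ^ 2 * exp (-M)) ≤ εd) (hτ0 : 0 ≤ τc) {Ain Aout : Set (Fin 5 → ℝ)}
    (hAin : c₀ • delayInit ∈ Ain) (hAout : ∀ p ∈ Aout, p 4 ≠ 0) :
    IsEmpty (ReachCertificate (delayCircuitWith K M ε) U εd τc Ain Aout) := by
  refine ⟨fun C => ?_⟩
  set y : ℝ → Fin 5 → ℝ := fun t => c₀ • seedFreeOrbit ε (c₀ * t) with hy
  have hy0 : y 0 = c₀ • delayInit := by simp [hy, seedFreeOrbit_zero]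
  have hcs : Continuous (seedFreeOrbit ε) :=
    continuous_iff_continuousAt.2 fun t => (hasDerivAt_seedFreeOrbit ε t).continuousAt
  have hcont : ContinuousOn y (Icc 0 τc) :=
    ((hcs.comp (continuous_const_mul c₀)).const_smul c₀).continuousOn
  have hW : ∀ σ ∈ Ico 0 τc, ∃ W : Fin 5 → ℝ, HasDerivWithinAt y W (Ici σ) σ ∧
      ‖W - delayCircuitWith K M ε (y σ)‖ ≤ εd := by
    intro σ _
    have hD := (hasDerivAt_seedFreeOrbit ε (c₀ * σ)).hasDerivWithinAt (s := Ici (c₀ * σ))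
    have h1 := hasDerivWithinAt_comp_mul hc₀ hD
    refine ⟨_, h1.const_smul c₀, ?_⟩
    show ‖c₀ • (c₀ • _) - delayCircuitWith K M ε (c₀ • seedFreeOrbit ε (c₀ * σ))‖ ≤ εd
    rw [delayCircuitWith_smul, smul_smul, ← pow_two, ← smul_sub, norm_smul, Real.norm_eq_abs,
      abs_of_nonneg (sq_nonneg c₀)]
    exact (mul_le_mul_of_nonneg_left (norm_seedFreeOrbit_defectWith_le K M ε (c₀ * σ))
      (sq_nonneg c₀)).trans hεd
  obtain ⟨σ, -, hA⟩ := C.reach hU hAin hτ0 hy0 hcont hW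
  exact hAout _ hA (by simp [hy])

/-- … in particular into a CONE over a fired set `firedSet K e m` (`e < K²⁰`, `K > 0`; then
`ã > 0` on the cone), from any input class containing `c₀ • delayInit`, at any cycle time `τc ≥ 0`.
[cite: Tao2016AveragedNS, §5.5 Theorem 5.3, Remark 6.1] -/
theorem isEmpty_reachCertificate_coneFiredSet_of_sq_mul_seed_le {K M ε c₀ : ℝ} (hK : 0 < K)
    (hc₀ : 0 < c₀) {U : Set (Fin 5 → ℝ)} (hU : IsOpen U) {εd τc : ℝ}
    (hεd : c₀ ^ 2 * (ε ^ 2 * exp (-M)) ≤ εd) (hτ0 : 0 ≤ τc) {Ain : Set (Fin 5 → ℝ)}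
    (hAin : c₀ • delayInit ∈ Ain) {e m : ℝ} (he : e < K ^ 20) :
    IsEmpty (ReachCertificate (delayCircuitWith K M ε) U εd τc Ain (coneFrom c₀ (firedSet K e m))) :=
  isEmpty_reachCertificate_of_sq_mul_seed_le hc₀ hU hεd hτ0 hAin fun _ hp =>
    (four_pos_of_mem_coneFrom_firedSet hK he hc₀ hp).ne'

/-- **The level-`c₀` defect axis is closed from above at `c₀²·ε²e^{-M}`**: for the classes of the
cone certificates (`U = univ`, `Ain = coneFrom c₀ (closedBall delayInit ρ)` with `ρ ≥ 0`,
`Aout = coneFrom c₀ (firedSet K 6 4)`, `K ≥ 2`, `c₀ > 0`) NO reach certificate exists at ANY cycle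
time once `εd ≥ c₀²·ε²e^{-M}` — the seed rate of the level-`c₀` copy of the member.
[cite: Tao2016AveragedNS, §5.5 Theorem 5.3, Remark 6.1] -/
theorem isEmpty_taoReachCone_of_seed_le {K M ε c₀ ρ εd τc : ℝ} (hK : 2 ≤ K) (hc₀ : 0 < c₀)
    (hρ : 0 ≤ ρ) (hεd : c₀ ^ 2 * (ε ^ 2 * exp (-M)) ≤ εd) (hτ0 : 0 ≤ τc) :
    IsEmpty (ReachCertificate (delayCircuitWith K M ε) (univ : Set (Fin 5 → ℝ)) εd τc
      (coneFrom c₀ (closedBall delayInit ρ)) (coneFrom c₀ (firedSet K 6 4))) := by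
  have h20 : (2 : ℝ) ^ 20 ≤ K ^ 20 := pow_le_pow_left₀ (by norm_num) hK 20
  exact isEmpty_reachCertificate_coneFiredSet_of_sq_mul_seed_le (by linarith) hc₀ isOpen_univ hεd
    hτ0 (smul_mem_coneFrom le_rfl (mem_closedBall_self hρ)) (by norm_num at h20 ⊢; linarith)

section StandingNecessity

variable {K M ε : ℝ} (hK : 2 * 20 ^ 42 * (Nat.factorial 42 : ℝ) + 16 ≤ K)
  (hML : 3000 * Real.log K ≤ M) (hMK : M ≤ K ^ 10) (hε : 0 < ε)
  (hεle : ε ≤ exp (-(10 * M)) / K ^ 100)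
include hK hML hMK hε hεle

/-- **No reach certificate beyond the dud level, at any level `c₀ > 0`.** Under the standing
hypotheses, for every open `U`, defect `εd ≥ 0`, cycle time `0 ≤ τc ≤ 2/c₀`, input class `Ain`
containing `c₀ • q` for every `q ∈ closedBall delayInit ρ` with `ρ ≥ 1.2535·ε²e^{-M}/√M`, and output
class `Aout ⊆ {ã > 6c₀e^{-M}}`: the interface is EMPTY — the RESCALED negative-kick dud
`t ↦ c₀ • Φ_{c₀t}(kickInit (-κ))` (`isEmpty_reachCertificate_of_negKick`: `c₀ = 1`) is an exact orbit
from `c₀ • kickInit (-κ) ∈ Ain` with `|ã| ≤ 6c₀e^{-M}` up to time `2/c₀`.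
[cite: Tao2016AveragedNS, §5.5 Theorem 5.3, Remark 6.1] -/
theorem isEmpty_reachCertificate_of_ge_level {c₀ : ℝ} (hc₀ : 0 < c₀) {U : Set (Fin 5 → ℝ)}
    (hU : IsOpen U) {εd τc ρ : ℝ} (hεd : 0 ≤ εd) (hτ0 : 0 ≤ τc) (hτ2 : τc ≤ 2 / c₀)
    {Ain Aout : Set (Fin 5 → ℝ)} (hAin : ∀ q ∈ closedBall delayInit ρ, c₀ • q ∈ Ain)
    (hρ : 2507 / 2000 * (ε ^ 2 * exp (-M)) / Real.sqrt M ≤ ρ)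
    (hAout : ∀ p ∈ Aout, 6 * c₀ * exp (-M) < p 4) :
    IsEmpty (ReachCertificate (delayCircuitWith K M ε) U εd τc Ain Aout) := by
  refine ⟨fun C => ?_⟩
  obtain ⟨-, hM4, -, -, -, -⟩ := negKick_params hK hML hMK hε hεle
  obtain ⟨-, h2⟩ := dud_level_le hK hML hMK hε hεle
  obtain ⟨κ, hκ1, hκ2, -, hdud⟩ := exists_negativeKick_dud_pinned hK hML hMK hε hεle
  have hsq0 : 0 < Real.sqrt M := Real.sqrt_pos.2 (by linarith)
  have hL0 : 0 < 3133 / 2500 * (ε ^ 2 * exp (-M)) / Real.sqrt M := by positivity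
  have hκ0 : 0 < κ := hL0.trans hκ1
  have hκle : κ ≤ 1 := by linarith
  have hq : kickInit (-κ) ∈ closedBall delayInit ρ := by
    rw [mem_closedBall, dist_eq_norm]
    exact (norm_kickInit_neg_sub_delayInit hκ0.le hκle).trans (hκ2.le.trans hρ)
  set x : ℝ → Fin 5 → ℝ := fun t => delayFlowWith K M ε t (kickInit (-κ)) with hxdef
  set y : ℝ → Fin 5 → ℝ := fun t => c₀ • x (c₀ * t) with hydef
  have hy0 : y 0 = c₀ • kickInit (-κ) := by simp [hydef, hxdef, delayFlowWith_zero]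
  have hder : ∀ t, HasDerivAt x (delayCircuitWith K M ε (x t)) t := fun t =>
    hasDerivAt_delayFlowWith K M ε _ t
  have hcx : Continuous x := continuous_iff_continuousAt.2 fun t => (hder t).continuousAt
  have hcont : ContinuousOn y (Icc 0 τc) :=
    ((hcx.comp (continuous_const_mul c₀)).const_smul c₀).continuousOn
  have hW : ∀ σ ∈ Ico 0 τc, ∃ W : Fin 5 → ℝ,
      HasDerivWithinAt y W (Ici σ) σ ∧ ‖W - delayCircuitWith K M ε (y σ)‖ ≤ εd := by
    intro σ _
    have hD := (hder (c₀ * σ)).hasDerivWithinAt (s := Ici (c₀ * σ))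
    have h1 := hasDerivWithinAt_comp_mul hc₀ hD
    refine ⟨_, h1.const_smul c₀, ?_⟩
    show ‖c₀ • (c₀ • _) - delayCircuitWith K M ε (c₀ • x (c₀ * σ))‖ ≤ εd
    rw [delayCircuitWith_smul, smul_smul, ← pow_two, sub_self, norm_zero]
    exact hεd
  obtain ⟨σ, hσ, hA⟩ := C.reach hU (hAin _ hq) hτ0 hy0 hcont hW
  have h1 := hAout _ hA
  have hcσ : c₀ * σ ∈ Icc (0 : ℝ) 2 := by
    refine ⟨mul_nonneg hc₀.le hσ.1, ?_⟩
    have := mul_le_mul_of_nonneg_left (hσ.2.trans hτ2) hc₀.le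
    rwa [mul_div_cancel₀ _ hc₀.ne'] at this
  have h3 := (abs_le.1 (hdud (c₀ * σ) hcσ).2.2.2).2
  have h4 : y σ 4 = c₀ * x (c₀ * σ) 4 := by simp [hydef]
  rw [h4] at h1
  have h5 : c₀ * x (c₀ * σ) 4 ≤ c₀ * (6 * exp (-M)) := mul_le_mul_of_nonneg_left h3 hc₀.le
  linarith

/-- **The level-`c₀` pre-load axis is closed from above at the dud level `1.2535·u`**
(`u = ε²e^{-M}/√M`): for the classes of the cone certificates (`U = univ`,
`Ain = coneFrom c₀ (closedBall delayInit ρ)`, `Aout = coneFrom c₀ (firedSet K 6 4)`) and every cycle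
time `τc ≤ 2/c₀`, NO reach certificate exists once `ρ ≥ 1.2535·u` — at every level `c₀ > 0`
(`isEmpty_taoReach_of_ge`: `c₀ = 1`, balls). [cite: Tao2016AveragedNS, §5.5 Theorem 5.3, Remark 6.1] -/
theorem isEmpty_taoReachCone_of_ge {c₀ εd ρ τc : ℝ} (hc₀ : 0 < c₀) (hεd : 0 ≤ εd) (hτ0 : 0 ≤ τc)
    (hτ2 : τc ≤ 2 / c₀) (hρ : 2507 / 2000 * (ε ^ 2 * exp (-M)) / Real.sqrt M ≤ ρ) :
    IsEmpty (ReachCertificate (delayCircuitWith K M ε) (univ : Set (Fin 5 → ℝ)) εd τc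
      (coneFrom c₀ (closedBall delayInit ρ)) (coneFrom c₀ (firedSet K 6 4))) := by
  obtain ⟨hK16, -, -, -, -, hexpM⟩ := negKick_params hK hML hMK hε hεle
  have hK0 : 0 < K := by linarith
  have hK20 : (6 : ℝ) ≤ K ^ 20 / 2 := by
    have : (16 : ℝ) ≤ K ^ 20 := by
      calc (16 : ℝ) ≤ K := hK16
        _ = K ^ 1 := (pow_one K).symm
        _ ≤ K ^ 20 := pow_le_pow_right₀ (by linarith) (by norm_num)
    linarith
  refine isEmpty_reachCertificate_of_ge_level hK hML hMK hε hεle hc₀ isOpen_univ hεd hτ0 hτ2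
    (fun q hq => smul_mem_coneFrom le_rfl hq) hρ fun p hp => ?_
  have h := half_le_four_of_mem_coneFrom_firedSet hK0 hK20 hc₀.le hp
  have : 6 * c₀ * exp (-M) ≤ 6 * c₀ * (1 / 50) := mul_le_mul_of_nonneg_left hexpM (by positivity)
  linarith

end StandingNecessity

/-! ## §2. Sufficiency at every level: the cone and band certificates on the weighted half-plane

`reachCertificateCone` / `reachCertificateBand` (ReachScaling.lean) consume exactly the firing
property `FiresAtTwo K M ε 6 4 ρ (εd/c₀²)` of the level-one member; `firesAtTwo_halfPlane`
(ReachHalfPlane.lean) supplies it on the whole open weighted half-plane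
`ρ + 1.27·(εd/c₀²)/√M < 1.2532·u` — no a-priori side condition. -/

section Standing

variable {K M ε : ℝ} (hK : 2 * 20 ^ 42 * (Nat.factorial 42 : ℝ) + 16 ≤ K)
  (hML : 3000 * Real.log K ≤ M) (hMK : M ≤ K ^ 10) (hε : 0 < ε)
  (hεle : ε ≤ exp (-(10 * M)) / K ^ 100)
include hK hML hMK hε hεle

/-- On the (closed) weighted half-plane the smallness side condition of the certificate
constructors holds with astronomic room: `7ρ + 40δ ≤ 5/4` (indeed `ρ ≤ s/60`, `δ ≤ s`,
`s = ε²e^{-M} ≤ 10⁻¹¹`). [cite: Tao2016AveragedNS, §5.5 Theorem 5.3] -/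
theorem halfPlane_small {ρ δ : ℝ} (hρ : 0 ≤ ρ) (hδ : 0 ≤ δ)
    (hW : ρ + 127 / 100 * δ / Real.sqrt M ≤ 3133 / 2500 * (ε ^ 2 * exp (-M)) / Real.sqrt M) :
    7 * ρ + 40 * δ ≤ 5 / 4 := by
  obtain ⟨-, -, hε2, hexpM, -, -, -, h77, -⟩ := Ignition.ignition_params hK hML hMK hε hεle
  have h2 : ε ^ 2 * exp (-M) ≤ 1 / 100000 * (1 / 1000000) :=
    mul_le_mul hε2 hexpM (exp_pos _).le (by norm_num)
  obtain ⟨hρs, hδs⟩ := wideBudget_of_weighted h77 hρ hδ hW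
  linarith

/-- **Tao's gate on CONES over the weighted half-plane**: under the standing hypotheses, for every
level `c₀ > 0` and all `ρ, εd ≥ 0` with `ρ + 1.27·(εd/c₀²)/√M < 1.2532·ε²e^{-M}/√M`, a reach
certificate for `delayCircuitWith K M ε` with working region `univ`, defect `εd`, cycle time
`2/c₀`, from `coneFrom c₀ (closedBall delayInit ρ)` into `coneFrom c₀ (firedSet K 6 4)` — the cone
certificate `taoReachCone` of ReachScaling.lean with its budget `ρ + 2εd/c₀² < 1.2532·u` replaced by
the weighted half-plane (which contains it: `1.27/√M ≤ 2`). At level `c₀` the defect is heard as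
`εd/c₀²` (homogeneity). [cite: Tao2016AveragedNS, §5.5 Theorem 5.3, Remark 6.1] -/
def taoReachCone_wide {c₀ ρ εd : ℝ} (hc₀ : 0 < c₀) (hρ : 0 ≤ ρ) (hεd : 0 ≤ εd)
    (hW : ρ + 127 / 100 * (εd / c₀ ^ 2) / Real.sqrt M <
      3133 / 2500 * (ε ^ 2 * exp (-M)) / Real.sqrt M) :
    ReachCertificate (delayCircuitWith K M ε) (univ : Set (Fin 5 → ℝ)) εd (2 / c₀)
      (coneFrom c₀ (closedBall delayInit ρ)) (coneFrom c₀ (firedSet K 6 4)) :=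
  reachCertificateCone
    (fun x hx h0 => firesAtTwo_halfPlane hK hML hMK hε hεle hW x hx h0)
    hc₀ hρ hεd (halfPlane_small hK hML hMK hε hεle hρ (by positivity) hW.le)

/-- The tube of `taoReachCone_wide` from `p` is the closed sup-ball of radius `(3/2)‖p‖/(1 - ρ)`.
[folklore] -/
theorem taoReachCone_wide_tube {c₀ ρ εd : ℝ} (hc₀ : 0 < c₀) (hρ : 0 ≤ ρ) (hεd : 0 ≤ εd)
    (hW : ρ + 127 / 100 * (εd / c₀ ^ 2) / Real.sqrt M <
      3133 / 2500 * (ε ^ 2 * exp (-M)) / Real.sqrt M)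
    (p : Fin 5 → ℝ) (σ : ℝ) :
    (taoReachCone_wide hK hML hMK hε hεle hc₀ hρ hεd hW).Tube p σ =
      closedBall (0 : Fin 5 → ℝ) (3 / 2 * ‖p‖ / (1 - ρ)) :=
  rfl

/-- **Tao's gate on BANDS over the weighted half-plane**: as `taoReachCone_wide`, from
`bandFrom c₀ c₁ (closedBall delayInit ρ)` into `bandFrom c₀ c₁ (firedSet K 6 4)` for every upper
level `c₁` — levels preserved exactly (`taoReachBand` of ReachScaling.lean on the half-plane).
[cite: Tao2016AveragedNS, §5.5 Theorem 5.3, Remark 6.1] -/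
def taoReachBand_wide {c₀ ρ εd : ℝ} (hc₀ : 0 < c₀) (hρ : 0 ≤ ρ) (hεd : 0 ≤ εd)
    (hW : ρ + 127 / 100 * (εd / c₀ ^ 2) / Real.sqrt M <
      3133 / 2500 * (ε ^ 2 * exp (-M)) / Real.sqrt M) (c₁ : ℝ) :
    ReachCertificate (delayCircuitWith K M ε) (univ : Set (Fin 5 → ℝ)) εd (2 / c₀)
      (bandFrom c₀ c₁ (closedBall delayInit ρ)) (bandFrom c₀ c₁ (firedSet K 6 4)) :=
  reachCertificateBand
    (fun x hx h0 => firesAtTwo_halfPlane hK hML hMK hε hεle hW x hx h0)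
    hc₀ hρ hεd (halfPlane_small hK hML hMK hε hεle hρ (by positivity) hW.le) c₁

/-- **The level-`c₀` defect axis** (`ρ = 0`): a cone certificate for EVERY defect level
`0 ≤ εd < 0.9867·c₀²·ε²e^{-M}` (`1.27·0.9867 < 1.2532`) — the level-`c₀` copy of the member
tolerates an adversarial forcing up to (essentially) ITS OWN seed rate `c₀²·ε²e^{-M}`
(`isEmpty_taoReachCone_of_seed_le`: none from `εd ≥ c₀²·ε²e^{-M}`).
[cite: Tao2016AveragedNS, §5.5 Theorem 5.3, Remark 6.1] -/
def taoReachCone_defectAxis_wide {c₀ εd : ℝ} (hc₀ : 0 < c₀) (hεd : 0 ≤ εd)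
    (h : εd < 9867 / 10000 * (c₀ ^ 2 * (ε ^ 2 * exp (-M)))) :
    ReachCertificate (delayCircuitWith K M ε) (univ : Set (Fin 5 → ℝ)) εd (2 / c₀)
      (coneFrom c₀ (closedBall delayInit 0)) (coneFrom c₀ (firedSet K 6 4)) :=
  taoReachCone_wide hK hML hMK hε hεle hc₀ le_rfl hεd
    (by
      obtain ⟨-, -, -, -, -, -, -, h77, -⟩ := Ignition.ignition_params hK hML hMK hε hεle
      have hsq0 : (0 : ℝ) < Real.sqrt M := by linarith
      have hc2 : (0 : ℝ) < c₀ ^ 2 := by positivity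
      have hq : εd / c₀ ^ 2 < 9867 / 10000 * (ε ^ 2 * exp (-M)) := by
        rw [div_lt_iff₀ hc2]; linarith
      have hs0 : 0 ≤ ε ^ 2 * exp (-M) := by positivity
      rw [zero_add]
      exact div_lt_div_of_pos_right (by linarith) hsq0)

/-! ## §3. The phase portrait at every level -/

/-- **The level-`c₀` defect axis, both sides**: certified for `0 ≤ εd < 0.9867·c₀²·ε²e^{-M}`
(cycle time `2/c₀`), impossible for `εd ≥ c₀²·ε²e^{-M}` (every cycle time `τc ≥ 0`) — the
level-one statement `defectAxis_phases_wide` transported EXACTLY by the scaling symmetry: the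
forcing a level-`c₀` Theorem-5.3 stage tolerates is `c₀²` times the seed rate, decided to the factor
`1.0135` at every level. [cite: Tao2016AveragedNS, §5.5 Theorem 5.3, Remark 6.1] -/
theorem cone_defectAxis_phases_wide {c₀ εd : ℝ} (hc₀ : 0 < c₀) (hεd : 0 ≤ εd) :
    (εd < 9867 / 10000 * (c₀ ^ 2 * (ε ^ 2 * exp (-M))) →
        Nonempty (ReachCertificate (delayCircuitWith K M ε) (univ : Set (Fin 5 → ℝ)) εd (2 / c₀)
          (coneFrom c₀ (closedBall delayInit 0)) (coneFrom c₀ (firedSet K 6 4)))) ∧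
      (c₀ ^ 2 * (ε ^ 2 * exp (-M)) ≤ εd → ∀ τc : ℝ, 0 ≤ τc →
        IsEmpty (ReachCertificate (delayCircuitWith K M ε) (univ : Set (Fin 5 → ℝ)) εd τc
          (coneFrom c₀ (closedBall delayInit 0)) (coneFrom c₀ (firedSet K 6 4)))) := by
  obtain ⟨hK16, -, -, -, -, -⟩ := negKick_params hK hML hMK hε hεle
  exact ⟨fun h => ⟨taoReachCone_defectAxis_wide hK hML hMK hε hεle hc₀ hεd h⟩,
    fun hs τc hτ => isEmpty_taoReachCone_of_seed_le (by linarith) hc₀ le_rfl hs hτ⟩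

/-- **The `(ρ, εd)` budget plane at level `c₀`** (`u = ε²e^{-M}/√M`, `s = ε²e^{-M}`), for the
cone classes `coneFrom c₀ (closedBall delayInit ρ) → coneFrom c₀ (firedSet K 6 4)` over `univ`:
CERTIFIED (cycle time `2/c₀`) on the open weighted half-plane `ρ + 1.27·(εd/c₀²)/√M < 1.2532u`;
IMPOSSIBLE for `ρ ≥ 1.2535u` (every cycle time `≤ 2/c₀`) and for `εd ≥ c₀²s` (every cycle time) —
in the coordinates `(ρ, εd/c₀²)` and the clock `c₀t` this is the level-one portrait
`taoReach_phases_wide` exactly: BOTH sides of the reach interface are scale covariant.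
[cite: Tao2016AveragedNS, §5.5 Theorem 5.3, Remark 6.1] -/
theorem taoReachCone_phases_wide {c₀ ρ εd : ℝ} (hc₀ : 0 < c₀) (hρ : 0 ≤ ρ) (hεd : 0 ≤ εd) :
    (ρ + 127 / 100 * (εd / c₀ ^ 2) / Real.sqrt M < 3133 / 2500 * (ε ^ 2 * exp (-M)) / Real.sqrt M →
        Nonempty (ReachCertificate (delayCircuitWith K M ε) (univ : Set (Fin 5 → ℝ)) εd (2 / c₀)
          (coneFrom c₀ (closedBall delayInit ρ)) (coneFrom c₀ (firedSet K 6 4)))) ∧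
    (2507 / 2000 * (ε ^ 2 * exp (-M)) / Real.sqrt M ≤ ρ → ∀ τc : ℝ, 0 ≤ τc → τc ≤ 2 / c₀ →
        IsEmpty (ReachCertificate (delayCircuitWith K M ε) (univ : Set (Fin 5 → ℝ)) εd τc
          (coneFrom c₀ (closedBall delayInit ρ)) (coneFrom c₀ (firedSet K 6 4)))) ∧
    (c₀ ^ 2 * (ε ^ 2 * exp (-M)) ≤ εd → ∀ τc : ℝ, 0 ≤ τc →
        IsEmpty (ReachCertificate (delayCircuitWith K M ε) (univ : Set (Fin 5 → ℝ)) εd τc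
          (coneFrom c₀ (closedBall delayInit ρ)) (coneFrom c₀ (firedSet K 6 4)))) := by
  obtain ⟨hK16, -, -, -, -, -⟩ := negKick_params hK hML hMK hε hεle
  exact ⟨fun hW => ⟨taoReachCone_wide hK hML hMK hε hεle hc₀ hρ hεd hW⟩,
    fun hρ' τc hτ0 hτ2 => isEmpty_taoReachCone_of_ge hK hML hMK hε hεle hc₀ hεd hτ0 hτ2 hρ',
    fun hs τc hτ => isEmpty_taoReachCone_of_seed_le (by linarith) hc₀ hρ hs hτ⟩

/-- **The design hand-off chains the wide cone certificates**, at the floor unit `r = 1 - 6/K²⁰`: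
the output cone of `taoReachCone_wide` hands off into its own input cone, for every input radius
`ρ ≥ 0` — in particular for every `ρ` on the weighted half-plane (`handOff_taoReachCone_chains`,
ReachScaling.lean, restated next to the certificate it serves).
[cite: Tao2016AveragedNS, §6.1 (6.1), (6.4), Remark 6.1] -/
theorem handOff_taoReachCone_wide_chains {c₀ ρ εd : ℝ} (hc₀ : 0 < c₀) (hρ : 0 ≤ ρ) (hεd : 0 ≤ εd)
    (hW : ρ + 127 / 100 * (εd / c₀ ^ 2) / Real.sqrt M <
      3133 / 2500 * (ε ^ 2 * exp (-M)) / Real.sqrt M) :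
    Nonempty (ReachCertificate (delayCircuitWith K M ε) (univ : Set (Fin 5 → ℝ)) εd (2 / c₀)
        (coneFrom c₀ (closedBall delayInit ρ)) (coneFrom c₀ (firedSet K 6 4))) ∧
      handOff (1 - 6 / K ^ 20) '' coneFrom c₀ (firedSet K 6 4) ⊆
        coneFrom c₀ (closedBall delayInit ρ) :=
  ⟨⟨taoReachCone_wide hK hML hMK hε hεle hc₀ hρ hεd hW⟩,
    handOff_taoReachCone_chains hK hc₀ hρ⟩

end Standing

end Literature.Analysis.FluidPDE.Tao2016AveragedNS
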